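import Summits.CriticalPhenomena.PercolationContinuityZ3.Theorems.Transplant.GrigorchukPowerNcHaraSladeLaceDefs
import Mathlib.Algebra.Order.Chebyshev
import Literature.Barriers.CriticalPhenomena.SubexponentialGrowthZdProofs
import HarnessLib

/-!
# W4 — WLOG the lace kernel is coordinate-exchangeable: symmetrisation over `Sym(Fin k)` preserves `IsLaceKernel` and does not increase `laceNormE`

Proof file (`--supports stmt-CriticalPhenomena-4575 --as helper`), lane `prim-bschramm`, seat `prim-bschramm-gen-1` gen 12 (GEN pen); the bridge between DEFS-C's `laceBound`
(an infimum over ALL lace kernels) and «…LaceNormExchangeable»'s `k`-free bound (4′) (which wants a coordinate-EXCHANGEABLE kernel): coordinate permutations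
`x ↦ x ∘ σ` are automorphisms of `Cay(𝔊^k; std)` fixing `1`, so they preserve `τ_p`, the renewal identity and the lace norm; the renewal identity is AFFINE in the
kernel, so the `Sym(Fin k)`-average `K̄(x) = (k!)⁻¹ Σ_σ K(x ∘ σ)` of a lace kernel is an exchangeable lace kernel with `laceNormE K̄ ≤ laceNormE K` (convexity).
builds on p205010 (kernel theorem, internal audit signed; external expert review pending) — nothing here uses p205010.  Def-free (`K̄` is written out); no instance,
no notation, no sorry; stakes no claim, staffs nothing (S3a/S3b untouched).

* §1 the coordinate-permutation automorphisms: `mulSingle_comp_perm`, `exists_equiv_comp_perm`, `exists_iso_comp_perm`, `sum_gkGens_comp_perm`,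
  `tauFun_comp_perm`, `deltaFun_comp_perm`.
* §2 `isLaceKernel_comp_perm`, **`isLaceKernel_symmetrize`**, `symmetrize_comp_perm`.
* §3 `exists_omegaV_comp_perm` (`ω_ξ(x∘σ) = ω_η(x)` with `κ₀(η) = κ₀(ξ)`), `laceNormE_comp_perm_le`, **`laceNormE_symmetrize_le`**,
  **`exists_exchangeable_laceKernel`**: every lace kernel is dominated in lace norm by an exchangeable one.
[cite: HeydenreichVanDerHofstad2017, §6.2 (lace expansion identity), Prop. 8.3] [cite: BenjaminiSchramm1996, §2 (Cayley graphs: automorphisms)]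
-/

noncomputable section

namespace Summit.CriticalPhenomena.PercolationContinuityZ3.Theorems.Transplant

namespace Grigorchuk

namespace NcHaraSlade

open SimpleGraph Finset Literature.Probability.Percolation
open scoped ENNReal Classical

variable {k : ℕ}

/-! ## §1 Coordinate permutations are automorphisms of `Cay(𝔊^k; std)` fixing `1` -/

/-- `mulSingle j g ∘ σ = mulSingle (σ⁻¹ j) g`. [folklore] -/
theorem mulSingle_comp_perm (σ : Equiv.Perm (Fin k)) (j : Fin k) (g : ↥grigorchukGroup) :
    (Pi.mulSingle j g : GPow k) ∘ σ = Pi.mulSingle (σ.symm j) g := by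
  funext m
  simp only [Function.comp_apply, Pi.mulSingle_apply, Equiv.apply_eq_iff_eq_symm_apply]

/-- The bijection `x ↦ x ∘ σ` of `𝔊^k` (with inverse `x ↦ x ∘ σ⁻¹`). [folklore] -/
theorem exists_equiv_comp_perm (σ : Equiv.Perm (Fin k)) :
    ∃ e : GPow k ≃ GPow k, (∀ x, e x = x ∘ σ) ∧ ∀ x, e.symm x = x ∘ σ.symm :=
  ⟨⟨fun x => x ∘ σ, fun x => x ∘ σ.symm, fun x => by funext m; simp, fun x => by funext m; simp⟩, fun _ => rfl, fun _ => rfl⟩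

/-- **`x ↦ x ∘ σ` is a graph automorphism of `Cay(𝔊^k; std)`** (a letter in coordinate `j` becomes the same letter in coordinate `σ⁻¹ j`).
[cite: BenjaminiSchramm1996, §2 (Cayley graphs)] -/
theorem exists_iso_comp_perm (σ : Equiv.Perm (Fin k)) : ∃ γ : gkCay k ≃g gkCay k, ∀ x, γ x = x ∘ σ := by
  obtain ⟨e, he, hes⟩ := exists_equiv_comp_perm σ
  refine ⟨⟨e, ?_⟩, he⟩
  intro x y
  show (gkCay k).Adj (e x) (e y) ↔ (gkCay k).Adj x y
  rw [he, he, gkCay_adj_iff, gkCay_adj_iff]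
  constructor
  · rintro ⟨i, l, h⟩
    refine ⟨σ i, l, ?_⟩
    have h' : (y ∘ σ) ∘ σ.symm = (x ∘ σ * Pi.mulSingle i (Letter.toG l)) ∘ σ.symm := by rw [h]
    rw [Pi.mul_comp, mulSingle_comp_perm, Equiv.symm_symm] at h'
    simpa only [Function.comp_assoc, Equiv.self_comp_symm, Function.comp_id] using h'
  · rintro ⟨j, l, rfl⟩
    exact ⟨σ.symm j, l, by rw [Pi.mul_comp, mulSingle_comp_perm]⟩

/-- `S_k` is invariant under coordinate permutations: `s ∈ S_k ↔ s ∘ σ ∈ S_k`. [folklore] -/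
theorem mem_gkGens_comp_perm_iff (σ : Equiv.Perm (Fin k)) (s : GPow k) : s ∘ σ ∈ gkGens k ↔ s ∈ gkGens k := by
  constructor
  · intro h
    obtain ⟨⟨i, g⟩, hig, hs⟩ := Finset.mem_image.1 h
    have hs' : s = Pi.mulSingle (σ i) g := by
      have := congrArg (fun z : GPow k => z ∘ σ.symm) hs
      simp only [Function.comp_assoc, Equiv.self_comp_symm, Function.comp_id] at this
      rw [← this, mulSingle_comp_perm, Equiv.symm_symm]
    rw [hs']
    exact mulSingle_mem_gkGens (σ i) (Finset.mem_product.1 hig).2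
  · intro h
    obtain ⟨⟨i, g⟩, hig, rfl⟩ := Finset.mem_image.1 h
    rw [mulSingle_comp_perm]
    exact mulSingle_mem_gkGens (σ.symm i) (Finset.mem_product.1 hig).2

/-- Sums over `S_k` are invariant under `s ↦ s ∘ σ`. [folklore] -/
theorem sum_gkGens_comp_perm {M : Type} [AddCommMonoid M] (F : GPow k → M) (σ : Equiv.Perm (Fin k)) :
    ∑ s ∈ gkGens k, F (s ∘ σ) = ∑ s ∈ gkGens k, F s := by
  obtain ⟨e, he, -⟩ := exists_equiv_comp_perm σ
  refine Finset.sum_equiv e (fun s => ?_) (fun s _ => by rw [he])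
  rw [he, mem_gkGens_comp_perm_iff]

/-- **`τ_p(x ∘ σ) = τ_p(x)`** (automorphism invariance of the two-point function, «SubexponentialGrowthZdProofs» `real_openConn_iso`; cf. E4.3c `conn_iso`). [cite: AntunovicVeselic2007, §2] [cite: BenjaminiSchramm1996, §2] -/
theorem tauFun_comp_perm (p : unitInterval) (σ : Equiv.Perm (Fin k)) (x : GPow k) : tauFun k p (x ∘ σ) = tauFun k p x := by
  obtain ⟨γ, hγ⟩ := exists_iso_comp_perm σ
  have h1 : γ 1 = 1 := by rw [hγ]; rfl
  have hiso : conn (gkCay k) p (γ 1) (γ x) = conn (gkCay k) p 1 x :=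
    Literature.Barriers.CriticalPhenomena.real_openConn_iso γ p 1 x
  unfold tauFun
  rw [← hγ x, ← hiso, h1]

/-- `δ(x ∘ σ) = δ(x)`. [folklore] -/
theorem deltaFun_comp_perm (σ : Equiv.Perm (Fin k)) (x : GPow k) : deltaFun k (x ∘ σ) = deltaFun k x := by
  have hiff : x ∘ σ = 1 ↔ x = 1 := by
    constructor
    · intro h
      funext m
      have := congrFun h (σ.symm m)
      simpa using this
    · rintro rfl; rfl
  unfold deltaFun
  by_cases hx : x = 1
  · rw [if_pos hx, if_pos (hiff.2 hx)]
  · rw [if_neg hx, if_neg (fun h => hx (hiff.1 h))]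

/-! ## §2 Permuted and symmetrised lace kernels -/

/-- `Σ_{s∈S_k} τ_p(((x ∘ σ)·s)⁻¹ · (g ∘ σ)) = Σ_{s∈S_k} τ_p((x·s)⁻¹ · g)`. [folklore] -/
theorem sum_gkGens_tauFun_comp_perm (p : unitInterval) (σ : Equiv.Perm (Fin k)) (x g : GPow k) :
    ∑ s ∈ gkGens k, tauFun k p ((x ∘ σ * s)⁻¹ * (g ∘ σ)) = ∑ s ∈ gkGens k, tauFun k p ((x * s)⁻¹ * g) := by
  rw [← sum_gkGens_comp_perm (fun s => tauFun k p ((x ∘ σ * s)⁻¹ * (g ∘ σ))) σ]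
  refine Finset.sum_congr rfl fun s _ => ?_
  exact tauFun_comp_perm p σ ((x * s)⁻¹ * g)

/-- The renewal sum of a kernel `K` against `τ_p` is summable for every absolutely summable `K` (`|Σ_{s∈S_k} τ| ≤ 4k`). [folklore] -/
theorem summable_renewal_term (p : unitInterval) {K : GPow k → ℝ} (hK : Summable fun x => |K x|) (g : GPow k) :
    Summable fun x => K x * ∑ s ∈ gkGens k, tauFun k p ((x * s)⁻¹ * g) := by
  refine Summable.of_norm_bounded (g := fun x => |K x| * (4 * k)) (hK.mul_right _) fun x => ?_
  rw [Real.norm_eq_abs, abs_mul]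
  refine mul_le_mul_of_nonneg_left ?_ (abs_nonneg _)
  rw [abs_of_nonneg (Finset.sum_nonneg fun s _ => tauFun_nonneg p _)]
  calc ∑ s ∈ gkGens k, tauFun k p ((x * s)⁻¹ * g) ≤ ∑ _s ∈ gkGens k, (1 : ℝ) := Finset.sum_le_sum fun s _ => tauFun_le_one p _
    _ = 4 * k := by rw [Finset.sum_const, card_gkGens, nsmul_eq_mul, mul_one]; push_cast; ring

/-- The `δ`-part of the renewal sum is summable (finite support). [folklore] -/
theorem summable_delta_renewal_term (p : unitInterval) (g : GPow k) :
    Summable fun x => deltaFun k x * ∑ s ∈ gkGens k, tauFun k p ((x * s)⁻¹ * g) := by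
  refine summable_of_ne_finset_zero (s := ({1} : Finset (GPow k))) fun x hx => ?_
  rw [Finset.mem_singleton] at hx
  rw [deltaFun_of_ne_one hx, zero_mul]

/-- **A coordinate-permuted lace kernel is a lace kernel.** [cite: HeydenreichVanDerHofstad2017, §6.2] -/
theorem isLaceKernel_comp_perm {p : unitInterval} {K : GPow k → ℝ} (hK : IsLaceKernel k p K) (σ : Equiv.Perm (Fin k)) :
    IsLaceKernel k p fun x => K (x ∘ σ) := by
  obtain ⟨e, he, -⟩ := exists_equiv_comp_perm σ
  refine ⟨?_, fun g => ?_⟩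
  · have h := (e.summable_iff (f := fun x => |K x|)).2 hK.1
    exact h.congr fun x => by simp only [Function.comp_apply, he]
  · have h := hK.2 (g ∘ σ)
    rw [tauFun_comp_perm, deltaFun_comp_perm] at h
    rw [h]
    congr 1
    congr 1
    rw [← e.tsum_eq]
    refine tsum_congr fun x => ?_
    rw [he, deltaFun_comp_perm, sum_gkGens_tauFun_comp_perm]

/-- **The symmetrised kernel `K̄(x) = (k!)⁻¹ Σ_{σ∈Sym(Fin k)} K(x ∘ σ)` of a lace kernel is a lace kernel** (the renewal identity is affine in the kernel).
[cite: HeydenreichVanDerHofstad2017, §6.2] -/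
theorem isLaceKernel_symmetrize {p : unitInterval} {K : GPow k → ℝ} (hK : IsLaceKernel k p K) :
    IsLaceKernel k p fun x => (∑ σ : Equiv.Perm (Fin k), K (x ∘ σ)) / (Nat.factorial k : ℝ) := by
  have hN : (Nat.factorial k : ℝ) ≠ 0 := by positivity
  have hNpos : (0 : ℝ) < (Nat.factorial k : ℝ) := by positivity
  have hcard : (Fintype.card (Equiv.Perm (Fin k)) : ℝ) = Nat.factorial k := by rw [Fintype.card_perm, Fintype.card_fin]
  have hσ : ∀ σ : Equiv.Perm (Fin k), IsLaceKernel k p fun x => K (x ∘ σ) := fun σ => isLaceKernel_comp_perm hK σ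
  refine ⟨?_, fun g => ?_⟩
  · -- summability: `|K̄| ≤ (k!)⁻¹ Σ_σ |K ∘ σ|`
    refine Summable.of_nonneg_of_le (fun x => abs_nonneg _) (fun x => ?_)
      ((summable_sum fun σ (_ : σ ∈ (Finset.univ : Finset (Equiv.Perm (Fin k)))) => (hσ σ).1).div_const (Nat.factorial k : ℝ))
    rw [abs_div, abs_of_pos hNpos]
    exact div_le_div_of_nonneg_right (Finset.abs_sum_le_sum_abs _ _) hNpos.le
  · -- the renewal identity, averaged
    set S : GPow k → ℝ := fun x => ∑ s ∈ gkGens k, tauFun k p ((x * s)⁻¹ * g) with hS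
    have hD : Summable fun x => deltaFun k x * S x := summable_delta_renewal_term p g
    have hU : ∀ σ : Equiv.Perm (Fin k), Summable fun x => K (x ∘ σ) * S x := fun σ => summable_renewal_term p (hσ σ).1 g
    -- each permuted identity, with the `δ`-part split off
    have hid : ∀ σ : Equiv.Perm (Fin k), tauFun k p g = deltaFun k g + K (g ∘ σ) + (p : ℝ) * (∑' x, deltaFun k x * S x + ∑' x, K (x ∘ σ) * S x) := by
      intro σ
      have h := (hσ σ).2 g
      rw [← hD.tsum_add (hU σ)]
      simpa only [add_mul] using h
    -- average over `σ`
    have hsum := Finset.sum_congr rfl fun σ (_ : σ ∈ (Finset.univ : Finset (Equiv.Perm (Fin k)))) => hid σ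
    rw [Finset.sum_const, Finset.card_univ, nsmul_eq_mul, hcard] at hsum
    -- `hsum : k! · τ g = Σ_σ (δ g + K(g∘σ) + p (D + U_σ))`
    have hUbar : ∑' x, (∑ σ : Equiv.Perm (Fin k), K (x ∘ σ)) / (Nat.factorial k : ℝ) * S x =
        (∑ σ : Equiv.Perm (Fin k), ∑' x, K (x ∘ σ) * S x) / (Nat.factorial k : ℝ) := by
      rw [← Summable.tsum_finsetSum (fun σ _ => hU σ), ← tsum_div_const]
      refine tsum_congr fun x => ?_
      rw [← Finset.sum_mul]
      ring
    have hDbar : Summable fun x => (∑ σ : Equiv.Perm (Fin k), K (x ∘ σ)) / (Nat.factorial k : ℝ) * S x := by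
      have := ((summable_sum fun σ (_ : σ ∈ (Finset.univ : Finset (Equiv.Perm (Fin k)))) => hU σ).div_const (Nat.factorial k : ℝ))
      refine this.congr fun x => ?_
      rw [← Finset.sum_mul]
      ring
    rw [show (fun x => (deltaFun k x + (∑ σ : Equiv.Perm (Fin k), K (x ∘ σ)) / (Nat.factorial k : ℝ)) * S x) =
        fun x => deltaFun k x * S x + (∑ σ : Equiv.Perm (Fin k), K (x ∘ σ)) / (Nat.factorial k : ℝ) * S x from funext fun x => by ring,
      hD.tsum_add hDbar, hUbar]
    -- now pure algebra from `hsum`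
    simp only [Finset.sum_add_distrib, Finset.sum_const, Finset.card_univ, nsmul_eq_mul, hcard, ← Finset.mul_sum] at hsum
    field_simp
    linarith [hsum]

/-- **`K̄` is coordinate-exchangeable**: `K̄(x ∘ σ) = K̄(x)` (reindex the average by `τ ↦ σ τ`). [folklore] -/
theorem symmetrize_comp_perm (K : GPow k → ℝ) (σ : Equiv.Perm (Fin k)) (x : GPow k) :
    (∑ τ : Equiv.Perm (Fin k), K ((x ∘ σ) ∘ τ)) / (Nat.factorial k : ℝ) = (∑ τ : Equiv.Perm (Fin k), K (x ∘ τ)) / (Nat.factorial k : ℝ) := by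
  congr 1
  refine Fintype.sum_equiv (Equiv.mulLeft σ) _ _ fun τ => ?_
  simp only [Equiv.coe_mulLeft, Equiv.Perm.coe_mul, Function.comp_assoc]

/-! ## §3 The lace norm does not increase under symmetrisation -/

/-- **`ω_ξ(x ∘ σ) = ω_η(x)` for a test vector `η` with `κ₀(η) = κ₀(ξ)`** (`η = ξ ∘ (· ∘ σ)`, transported support). [cite: HeydenreichVanDerHofstad2017, §8.3] -/
theorem exists_omegaV_comp_perm (ξ : GPow k →₀ ℝ) (σ : Equiv.Perm (Fin k)) :
    ∃ η : GPow k →₀ ℝ, kappa0 k η = kappa0 k ξ ∧ ∀ x, omegaV ξ (x ∘ σ) = omegaV η x := by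
  obtain ⟨e, he, hes⟩ := exists_equiv_comp_perm σ
  -- `η b = ξ (b ∘ σ) = ξ (e b)`: `η = ξ.equivMapDomain e.symm`
  refine ⟨ξ.equivMapDomain e.symm, ?_, ?_⟩
  · have hω : ∀ x, omegaV (ξ.equivMapDomain e.symm) x = omegaV ξ (x ∘ σ) := by
      intro x
      unfold omegaV
      simp only [Finsupp.equivMapDomain_apply, Equiv.symm_symm]
      show (∑ y ∈ ξ.support.map e.symm.toEmbedding, ξ (e y) * ξ (e y)) - ∑ y ∈ ξ.support.map e.symm.toEmbedding, ξ (e y) * ξ (e (y * x)) =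
        (∑ y ∈ ξ.support, ξ y * ξ y) - ∑ y ∈ ξ.support, ξ y * ξ (y * (x ∘ σ))
      rw [Finset.sum_map, Finset.sum_map]
      simp only [Equiv.coe_toEmbedding, Equiv.apply_symm_apply]
      congr 1
      refine Finset.sum_congr rfl fun y _ => ?_
      rw [he, hes, Pi.mul_comp]
      simp only [Function.comp_assoc, Equiv.symm_comp_self, Function.comp_id]
    unfold kappa0
    rw [Finset.sum_congr rfl fun s _ => hω s, sum_gkGens_comp_perm (fun s => omegaV ξ s) σ]
  · intro x
    unfold omegaV
    simp only [Finsupp.equivMapDomain_apply, Equiv.symm_symm]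
    show (∑ y ∈ ξ.support, ξ y * ξ y) - ∑ y ∈ ξ.support, ξ y * ξ (y * (x ∘ σ)) =
      (∑ y ∈ ξ.support.map e.symm.toEmbedding, ξ (e y) * ξ (e y)) - ∑ y ∈ ξ.support.map e.symm.toEmbedding, ξ (e y) * ξ (e (y * x))
    rw [Finset.sum_map, Finset.sum_map]
    simp only [Equiv.coe_toEmbedding, Equiv.apply_symm_apply]
    congr 1
    refine Finset.sum_congr rfl fun y _ => ?_
    rw [he, hes, Pi.mul_comp]
    simp only [Function.comp_assoc, Equiv.symm_comp_self, Function.comp_id]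

/-- **`laceNormE (K ∘ (· ∘ σ)) ≤ laceNormE K`** (indeed `=`, by symmetry). [cite: HeydenreichVanDerHofstad2017, Prop. 8.3] -/
theorem laceNormE_comp_perm_le (K : GPow k → ℝ) (σ : Equiv.Perm (Fin k)) : laceNormE k (fun x => K (x ∘ σ)) ≤ laceNormE k K := by
  obtain ⟨e, he, hes⟩ := exists_equiv_comp_perm σ
  unfold laceNormE
  refine sup_le_sup ?_ (iSup₂_le fun ξ hξ => ?_)
  · -- `Σ' |K (x∘σ)| = Σ' |K x|`
    refine le_of_eq ?_
    rw [← e.tsum_eq (fun x => ENNReal.ofReal |K x|)]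
    exact tsum_congr fun x => by rw [he]
  · -- weighted part: transport the test vector by `σ⁻¹`
    obtain ⟨η, hκ, hω⟩ := exists_omegaV_comp_perm ξ σ.symm
    have hη : 0 < kappa0 k η := by rw [hκ]; exact hξ
    refine le_iSup₂_of_le η hη (le_of_eq ?_)
    rw [hκ]
    congr 2
    -- `Σ' |K(x∘σ)| ω_ξ(x) = Σ' |K y| ω_ξ(y ∘ σ⁻¹) = Σ' |K y| ω_η(y)`
    rw [← e.symm.tsum_eq (fun x => |K (x ∘ σ)| * omegaV ξ x)]
    refine tsum_congr fun y => ?_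
    rw [hes, hω y]
    simp only [Function.comp_assoc, Equiv.symm_comp_self, Function.comp_id]

/-- **Symmetrisation does not increase the lace norm**: `laceNormE K̄ ≤ laceNormE K` (the norm is convex and permutation-invariant).
[cite: HeydenreichVanDerHofstad2017, Prop. 8.3] -/
theorem laceNormE_symmetrize_le (K : GPow k → ℝ) :
    laceNormE k (fun x => (∑ σ : Equiv.Perm (Fin k), K (x ∘ σ)) / (Nat.factorial k : ℝ)) ≤ laceNormE k K := by
  have hN : (0 : ℝ) < Nat.factorial k := by positivity
  have hcard : (Fintype.card (Equiv.Perm (Fin k)) : ℝ≥0∞) = (Nat.factorial k : ℝ≥0∞) := by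
    rw [Fintype.card_perm, Fintype.card_fin]
  have hNtop : (Nat.factorial k : ℝ≥0∞) ≠ ⊤ := ENNReal.natCast_ne_top _
  have hN0 : (Nat.factorial k : ℝ≥0∞) ≠ 0 := by exact_mod_cast (Nat.factorial_pos k).ne'
  -- pointwise: `ofReal |K̄ x| ≤ (k!)⁻¹ Σ_σ ofReal |K(x∘σ)|`, and the same with weights
  have hpt : ∀ (w : ℝ), 0 ≤ w → ∀ x, ENNReal.ofReal (|(∑ σ : Equiv.Perm (Fin k), K (x ∘ σ)) / (Nat.factorial k : ℝ)| * w) ≤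
      (Nat.factorial k : ℝ≥0∞)⁻¹ * ∑ σ : Equiv.Perm (Fin k), ENNReal.ofReal (|K (x ∘ σ)| * w) := by
    intro w hw x
    rw [abs_div, abs_of_pos hN, ← ENNReal.ofReal_sum_of_nonneg fun σ _ => mul_nonneg (abs_nonneg _) hw, ← Finset.sum_mul,
      ← ENNReal.ofReal_natCast, ← ENNReal.ofReal_inv_of_pos hN, ← ENNReal.ofReal_mul (inv_nonneg.2 hN.le)]
    refine ENNReal.ofReal_le_ofReal ?_
    rw [div_mul_eq_mul_div, div_eq_inv_mul]
    exact mul_le_mul_of_nonneg_left (mul_le_mul_of_nonneg_right (Finset.abs_sum_le_sum_abs _ _) hw) (inv_nonneg.2 hN.le)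
  -- averaging bound in `ℝ≥0∞`: if each `a σ ≤ L` then `(k!)⁻¹ Σ_σ a σ ≤ L`
  have havg : ∀ (a : Equiv.Perm (Fin k) → ℝ≥0∞) (L : ℝ≥0∞), (∀ σ, a σ ≤ L) → (Nat.factorial k : ℝ≥0∞)⁻¹ * ∑ σ, a σ ≤ L := by
    intro a L ha
    calc (Nat.factorial k : ℝ≥0∞)⁻¹ * ∑ σ, a σ ≤ (Nat.factorial k : ℝ≥0∞)⁻¹ * ∑ _σ : Equiv.Perm (Fin k), L := by gcongr; exact ha _
      _ = L := by rw [Finset.sum_const, Finset.card_univ, nsmul_eq_mul, hcard, ← mul_assoc, ENNReal.inv_mul_cancel hN0 hNtop, one_mul]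
  unfold laceNormE
  refine sup_le ?_ (iSup₂_le fun ξ hξ => ?_)
  · -- `ℓ¹` part
    calc ∑' x, ENNReal.ofReal |(∑ σ : Equiv.Perm (Fin k), K (x ∘ σ)) / (Nat.factorial k : ℝ)|
        ≤ ∑' x, (Nat.factorial k : ℝ≥0∞)⁻¹ * ∑ σ : Equiv.Perm (Fin k), ENNReal.ofReal |K (x ∘ σ)| :=
          ENNReal.tsum_le_tsum fun x => by simpa only [mul_one] using hpt 1 zero_le_one x
      _ = (Nat.factorial k : ℝ≥0∞)⁻¹ * ∑ σ : Equiv.Perm (Fin k), ∑' x, ENNReal.ofReal |K (x ∘ σ)| := by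
          rw [ENNReal.tsum_mul_left, Summable.tsum_finsetSum (fun _ _ => ENNReal.summable)]
      _ ≤ (∑' x, ENNReal.ofReal |K x|) ⊔ ⨆ (ξ : GPow k →₀ ℝ) (_ : 0 < kappa0 k ξ), ENNReal.ofReal ((∑' x, |K x| * omegaV ξ x) / kappa0 k ξ) :=
          havg _ _ fun σ => (tsum_ofReal_abs_le_laceNormE (fun x => K (x ∘ σ))).trans (laceNormE_comp_perm_le K σ)
  · -- weighted part at a test vector `ξ`
    have hKs : ∀ σ : Equiv.Perm (Fin k), ENNReal.ofReal ((∑' x, |K (x ∘ σ)| * omegaV ξ x) / kappa0 k ξ) ≤ laceNormE k K := fun σ =>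
      (le_sup_of_le_right (le_iSup₂_of_le ξ hξ le_rfl) : _ ≤ laceNormE k (fun x => K (x ∘ σ))).trans (laceNormE_comp_perm_le K σ)
    -- is the weighted series of `K̄` summable?  If some `Σ' |K∘σ| ω` diverges, its `ofReal(…/κ₀)` is `0`-junk but then … we avoid junk by cases
    by_cases hsum : ∀ σ : Equiv.Perm (Fin k), Summable fun x => |K (x ∘ σ)| * omegaV ξ x
    · have hptw : ∀ x, |(∑ σ : Equiv.Perm (Fin k), K (x ∘ σ)) / (Nat.factorial k : ℝ)| * omegaV ξ x ≤
          (∑ σ : Equiv.Perm (Fin k), |K (x ∘ σ)| * omegaV ξ x) / (Nat.factorial k : ℝ) := fun x => by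
        rw [abs_div, abs_of_pos hN, div_mul_eq_mul_div, ← Finset.sum_mul]
        exact div_le_div_of_nonneg_right (mul_le_mul_of_nonneg_right (Finset.abs_sum_le_sum_abs _ _) (omegaV_nonneg ξ x)) hN.le
      have hsR : Summable fun x => (∑ σ : Equiv.Perm (Fin k), |K (x ∘ σ)| * omegaV ξ x) / (Nat.factorial k : ℝ) :=
        (summable_sum fun σ (_ : σ ∈ (Finset.univ : Finset (Equiv.Perm (Fin k)))) => hsum σ).div_const _
      have hbar : Summable fun x => |(∑ σ : Equiv.Perm (Fin k), K (x ∘ σ)) / (Nat.factorial k : ℝ)| * omegaV ξ x :=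
        Summable.of_nonneg_of_le (fun x => mul_nonneg (abs_nonneg _) (omegaV_nonneg ξ x)) hptw hsR
      have hA : ∑' x, |(∑ σ : Equiv.Perm (Fin k), K (x ∘ σ)) / (Nat.factorial k : ℝ)| * omegaV ξ x ≤
          (∑ σ : Equiv.Perm (Fin k), ∑' x, |K (x ∘ σ)| * omegaV ξ x) / (Nat.factorial k : ℝ) := by
        refine (hbar.tsum_le_tsum hptw hsR).trans (le_of_eq ?_)
        rw [tsum_div_const, Summable.tsum_finsetSum (fun σ _ => hsum σ)]
      have hle : (∑' x, |(∑ σ : Equiv.Perm (Fin k), K (x ∘ σ)) / (Nat.factorial k : ℝ)| * omegaV ξ x) / kappa0 k ξ ≤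
          (∑ σ : Equiv.Perm (Fin k), (∑' x, |K (x ∘ σ)| * omegaV ξ x) / kappa0 k ξ) / (Nat.factorial k : ℝ) := by
        rw [← Finset.sum_div, div_right_comm]
        exact div_le_div_of_nonneg_right hA hξ.le
      calc ENNReal.ofReal ((∑' x, |(∑ σ : Equiv.Perm (Fin k), K (x ∘ σ)) / (Nat.factorial k : ℝ)| * omegaV ξ x) / kappa0 k ξ)
          ≤ ENNReal.ofReal ((∑ σ : Equiv.Perm (Fin k), (∑' x, |K (x ∘ σ)| * omegaV ξ x) / kappa0 k ξ) / (Nat.factorial k : ℝ)) :=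
            ENNReal.ofReal_le_ofReal hle
        _ = (Nat.factorial k : ℝ≥0∞)⁻¹ * ∑ σ : Equiv.Perm (Fin k), ENNReal.ofReal ((∑' x, |K (x ∘ σ)| * omegaV ξ x) / kappa0 k ξ) := by
            rw [div_eq_inv_mul, ENNReal.ofReal_mul (inv_nonneg.2 hN.le), ENNReal.ofReal_inv_of_pos hN, ENNReal.ofReal_natCast,
              ENNReal.ofReal_sum_of_nonneg fun σ _ => div_nonneg (tsum_nonneg fun x => mul_nonneg (abs_nonneg _) (omegaV_nonneg ξ x)) hξ.le]
        _ ≤ laceNormE k K := havg _ _ hKs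
    · -- some permuted weighted series diverges: then `laceNormE K = ⊤` anyway
      obtain ⟨σ, hσ⟩ := not_forall.1 hsum
      have hK1 : ¬ Summable fun x => |K (x ∘ σ)| := fun h => hσ (summable_abs_mul_omegaV ξ h)
      have htop' : ∑' x, ENNReal.ofReal |K (x ∘ σ)| = ⊤ := by
        by_contra hne
        apply hK1
        have h1 : Summable fun x => (|K (x ∘ σ)|).toNNReal := ENNReal.tsum_coe_ne_top_iff_summable.1 hne
        exact (NNReal.summable_coe.2 h1).congr fun x => Real.coe_toNNReal _ (abs_nonneg _)
      have htop : laceNormE k K = ⊤ :=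
        eq_top_iff.2 ((le_of_eq htop'.symm).trans ((tsum_ofReal_abs_le_laceNormE (fun x => K (x ∘ σ))).trans (laceNormE_comp_perm_le K σ)))
      exact le_top.trans (le_of_eq htop.symm)

/-- **Every lace kernel is dominated in lace norm by a coordinate-EXCHANGEABLE lace kernel** (its `Sym(Fin k)`-average). [cite: HeydenreichVanDerHofstad2017, Prop. 8.3] -/
theorem exists_exchangeable_laceKernel {p : unitInterval} {K : GPow k → ℝ} (hK : IsLaceKernel k p K) :
    ∃ K' : GPow k → ℝ, IsLaceKernel k p K' ∧ (∀ σ : Equiv.Perm (Fin k), ∀ x : GPow k, K' (x ∘ σ) = K' x) ∧ laceNormE k K' ≤ laceNormE k K :=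
  ⟨fun x => (∑ σ : Equiv.Perm (Fin k), K (x ∘ σ)) / (Nat.factorial k : ℝ), isLaceKernel_symmetrize hK,
    fun σ x => symmetrize_comp_perm K σ x, laceNormE_symmetrize_le K⟩

/-- **`laceBound` is an infimum over EXCHANGEABLE lace kernels**: `laceBound k p = ⨅ {laceNormE K : K a lace kernel with K(x ∘ σ) = K(x)}` — so S3a's bound
`laceBound ≤ C/k` may be witnessed by an exchangeable kernel and estimated through the `k`-free (4′) of «…LaceNormExchangeable». [cite: HeydenreichVanDerHofstad2017, Prop. 8.3] -/
theorem laceBound_eq_iInf_exchangeable (p : unitInterval) :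
    laceBound k p = ⨅ (K : GPow k → ℝ) (_ : IsLaceKernel k p K ∧ ∀ σ : Equiv.Perm (Fin k), ∀ x : GPow k, K (x ∘ σ) = K x), laceNormE k K := by
  refine le_antisymm (le_iInf₂ fun K hK => laceBound_le hK.1) ?_
  unfold laceBound
  refine le_iInf₂ fun K hK => ?_
  obtain ⟨K', hK', hex, hle⟩ := exists_exchangeable_laceKernel hK
  exact (iInf₂_le K' ⟨hK', hex⟩).trans hle

end NcHaraSlade

end Grigorchuk

end Summit.CriticalPhenomena.PercolationContinuityZ3.Theorems.Transplant

end
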